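import Summits.HodgeConjecture.CorCM.IrreducibleOddWeightsCMTypes
import HarnessLib

/-!
# Irreducible slots: the rank of a family is a SUBSET SUM of the ranks of its members — for one (IRR) field the
# Hodge group of a product has dimension a MULTIPLE of `n`

COR-CM (cell `pub-hodgecm2`, binder seat `b16` gen 55, count-neutral claim IRR-ODD, file F6 — abstract `G`-set level,
sequel of F1/F1b `CorCM/IrreducibleOddWeights{,CMTypes}`; theorems only, no definition, no named fact, no `sorry`).  NEW
as stated, hence under `Summits/`.  HONEST FRAMING: finite-dimensional linear algebra about the Kubota–Dodson rank of
families of CM types (setting of `Literature/…/CMTypeRankFamilies`: a group `G` acting slot by slot on `⊔_i E_i`, types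
`Φ_i ⊆ E_i`, spans `U(Φ_i) = antiSpan G (Φ_i)`, family span `U(Σ)`, `rank = dim U + 1`); `HC_CM` is neither used nor
asserted.

THEOREM (`exists_finrank_antiSpan_sigmaType_eq_sum`).  If every `U(Φ_i)` is an IRREDUCIBLE `G`-module (e.g. every slot
is an (IRR) slot — F1b `antiSpan_irreducible_of_irreducible`; in particular every (SC) / pair-flip / double-flip slot),
then for some set `T ⊆ I` of slots

  `dim U(Σ) = Σ_{i ∈ T} dim U(Φ_i)`,   i.e.   `rank(Σ) − 1 = Σ_{i∈T} (rank(Φ_i) − 1)`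

— on Hodge groups: `dim Hg(∏_i A_i)` is a SUBSET SUM of the `dim Hg(A_i)`.  PROOF: filter `U(Σ)` by the subspaces
`M_S = {f ∈ U(Σ) : f|_{E_j} = 0 for j ∉ S}` (`S ⊆ I`); the slot restriction `r_i` maps `M_{S ∪ {i}}` with kernel `M_S`
onto a `G`-stable subspace of `r_i(U(Σ)) = U(Φ_i)` (tree: `map_funLeft_mk_antiSpan_sigmaType`), which is `0` or
`U(Φ_i)` by irreducibility; induct on `S` (`M_∅ = 0`, `M_I = U(Σ)`).  No semisimplicity, no Schur.

COROLLARIES.  `exists_finrank_antiSpan_sigmaType_eq_mul` — same-slot family with type vectors in ONE irreducible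
`A ≤ ℚ^X`: `dim U(Σ) = r · dim A` for some `r ≤ |I|`; `exists_typeRank_sigmaType_eq_mul_add_one` — CM types of an (IRR)
slot: `rank(Σ) = r·n + 1` (`|X| = 2n`), so `dim Hg(A_1 × ⋯ × A_k) ∈ n·ℕ` for abelian varieties with CM by one (IRR) field;
with F1b/F5 (`r = |I|` iff nondegenerate; `2|I| ≤ n` then off (M1)) e.g. for `n = 4`, `d = 2`: pairs have `rank − 1 ∈
{4, 8}`, triples `∈ {4, 8}` never `12` (numerics `HOME/pub-hodgecm2-b16/lean-g55/octic16.out`: for the `D₁₆`-, `SD₁₆`-,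
`M₁₆`-octics ALL 84 triples of pairwise non-opposite types have `rank − 1 = 8`; for `SD₁₆` all 14 non-opposite PAIRS are
additive — pairwise additivity without additivity).  Sequel F6b `CorCM/IrreducibleOddWeightsRankSubsetSumCMFields`.

## References

* [Gordon1999HodgeAVSurvey] B. B. Gordon, *A survey of the Hodge conjecture for abelian varieties*, §3 Theorem (proof:
  "`Hg(A)` surjects onto each factor"), 7.5–7.7.
* [Serre1977] J.-P. Serre, *Linear Representations of Finite Groups*, GTM 42 (1977), §2.2 (Goursat / Schur setting).
* [Deligne1982HodgeCycles] P. Deligne, *Hodge cycles on abelian varieties*, LNM 900 (1982), I Ex. 3.7.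
-/

set_option autoImplicit false

noncomputable section

open scoped BigOperators

universe u v w

namespace Summit.HodgeConjecture.CorCM.IrrOdd

open Literature.NumberTheory.ComplexMultiplication

variable {G : Type w} [Group G] {I : Type u} {X : Type v} [MulAction G X]

/-! ### §1 Irreducible slots: `dim U(Σ)` is a subset sum of the `dim U(Φ_i)` -/

section SubsetSum

variable {E : I → Type v} [∀ i, MulAction G (E i)] [DecidableEq I] [Fintype I] [∀ i, Fintype (E i)]

/-- **THE SUBSET-SUM THEOREM.**  If every `U(Φ_i)` is an irreducible `G`-module, then
`dim U(Σ) = Σ_{i∈T} dim U(Φ_i)` for some set of slots `T` (filtration of `U(Σ)` by the slots on which its members may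
be non-zero; each graded piece is a stable subspace of an irreducible `U(Φ_i)`).
[cite: Gordon1999HodgeAVSurvey, §3 Theorem (proof)] [cite: Serre1977, §2.2] -/
theorem exists_finrank_antiSpan_sigmaType_eq_sum (Φ : ∀ i, Set (E i))
    (hirr : ∀ i, ∀ W : Submodule ℚ (E i → ℚ), W ≤ antiSpan G (Φ i) → W ≠ ⊥ →
      (∀ (k : G) (f : E i → ℚ), f ∈ W → (fun y => f (k • y)) ∈ W) → W = antiSpan G (Φ i)) :
    ∃ T : Finset I, Module.finrank ℚ (antiSpan G (sigmaType Φ)) =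
      ∑ i ∈ T, Module.finrank ℚ (antiSpan G (Φ i)) := by
  classical
  -- slot restrictions and the filtration
  let r : ∀ j : I, ((Σ i, E i) → ℚ) →ₗ[ℚ] (E j → ℚ) := fun j => LinearMap.funLeft ℚ ℚ (Sigma.mk j)
  let U : Submodule ℚ ((Σ i, E i) → ℚ) := antiSpan G (sigmaType Φ)
  let M : Finset I → Submodule ℚ ((Σ i, E i) → ℚ) := fun S => U ⊓ ⨅ j, ⨅ (_ : j ∉ S), LinearMap.ker (r j)
  have hM : ∀ (S : Finset I) (f : (Σ i, E i) → ℚ), f ∈ M S ↔ f ∈ U ∧ ∀ j, j ∉ S → r j f = 0 := fun S f => by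
    simp only [M, Submodule.mem_inf, Submodule.mem_iInf, LinearMap.mem_ker]
  have hUst : ∀ (k : G) (f : (Σ i, E i) → ℚ), f ∈ U → (fun x => f (k • x)) ∈ U :=
    fun k f hf => comp_smul_mem_antiSpan hf k
  have hrk : ∀ (j : I) (k : G) (f : (Σ i, E i) → ℚ), r j (fun x => f (k • x)) = fun s => r j f (k • s) :=
    fun j k f => rfl
  have hMst : ∀ (S : Finset I) (k : G) (f : (Σ i, E i) → ℚ), f ∈ M S → (fun x => f (k • x)) ∈ M S := by
    intro S k f hf
    rw [hM] at hf ⊢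
    refine ⟨hUst k f hf.1, fun j hj => ?_⟩
    rw [hrk, hf.2 j hj]
    rfl
  -- induction on `S`
  have key : ∀ S : Finset I, ∃ T : Finset I, T ⊆ S ∧
      Module.finrank ℚ (M S) = ∑ i ∈ T, Module.finrank ℚ (antiSpan G (Φ i)) := by
    intro S
    induction S using Finset.induction_on with
    | empty =>
      refine ⟨∅, Finset.Subset.refl _, ?_⟩
      rw [Finset.sum_empty, Submodule.finrank_eq_zero]
      rw [eq_bot_iff]
      intro f hf
      rw [hM] at hf
      rw [Submodule.mem_bot]
      funext x
      obtain ⟨j, s⟩ := x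
      have h1 := congrFun (hf.2 j (Finset.notMem_empty j)) s
      exact h1
    | @insert i S hiS ih =>
      obtain ⟨T, hTS, hT⟩ := ih
      -- the restriction `φ = r_i |_{M (insert i S)}`
      let φ : M (insert i S) →ₗ[ℚ] (E i → ℚ) := (r i).domRestrict (M (insert i S))
      have hker : Module.finrank ℚ (LinearMap.ker φ) = Module.finrank ℚ (M S) := by
        have h1 : (LinearMap.ker φ).map (M (insert i S)).subtype = M S := by
          rw [LinearMap.ker_domRestrict, Submodule.map_comap_subtype]
          ext f
          rw [Submodule.mem_inf, LinearMap.mem_ker, hM, hM]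
          constructor
          · rintro ⟨⟨hfU, hfS⟩, hfi⟩
            refine ⟨hfU, fun j hj => ?_⟩
            by_cases hji : j = i
            · subst hji
              exact hfi
            · exact hfS j (fun h => (Finset.mem_insert.1 h).elim hji hj)
          · rintro ⟨hfU, hfS⟩
            exact ⟨⟨hfU, fun j hj => hfS j fun h => hj (Finset.mem_insert_of_mem h)⟩, hfS i hiS⟩
        rw [← h1, Submodule.finrank_map_subtype_eq]
      -- the image is a stable subspace of `U(Φ_i)`
      have hrange : LinearMap.range φ = (M (insert i S)).map (r i) := LinearMap.range_domRestrict _ _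
      have hWle : (M (insert i S)).map (r i) ≤ antiSpan G (Φ i) := by
        rw [← map_funLeft_mk_antiSpan_sigmaType Φ i]
        exact Submodule.map_mono inf_le_left
      have hWst : ∀ (k : G) (f : E i → ℚ), f ∈ (M (insert i S)).map (r i) →
          (fun y => f (k • y)) ∈ (M (insert i S)).map (r i) := by
        rintro k _ ⟨f, hf, rfl⟩
        exact ⟨fun x => f (k • x), hMst _ k f hf, hrk i k f⟩
      have hrn := LinearMap.finrank_range_add_finrank_ker φ
      rw [hker, hrange] at hrn
      by_cases hW0 : (M (insert i S)).map (r i) = ⊥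
      · refine ⟨T, hTS.trans (Finset.subset_insert i S), ?_⟩
        rw [hW0, finrank_bot, zero_add] at hrn
        rw [← hrn, hT]
      · refine ⟨insert i T, Finset.insert_subset_insert i hTS, ?_⟩
        rw [hirr i _ hWle hW0 hWst] at hrn
        rw [Finset.sum_insert (fun h => hiS (hTS h)), ← hT, ← hrn, add_comm]
  obtain ⟨T, -, hT⟩ := key Finset.univ
  refine ⟨T, ?_⟩
  have hMuniv : M Finset.univ = U := by
    refine le_antisymm inf_le_left fun f hf => (hM _ f).2 ⟨hf, fun j hj => (hj (Finset.mem_univ j)).elim⟩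
  rw [← hT, hMuniv]

/-- **Rank form**: `rank(Σ) − 1 = Σ_{i∈T} (rank(Φ_i) − 1)` for some `T ⊆ I`, i.e.
`rank(Σ) + |T| = Σ_{i∈T} rank(Φ_i) + 1`. [cite: Gordon1999HodgeAVSurvey, §3 Theorem (proof) and 7.5–7.7] -/
theorem exists_typeRank_sigmaType_add_card_eq_sum [Nonempty I] [∀ i, Nonempty (E i)] {ρ : G} (Φ : ∀ i, Set (E i))
    (h : ∀ i, IsCMTypeWith ρ (Φ i))
    (hirr : ∀ i, ∀ W : Submodule ℚ (E i → ℚ), W ≤ antiSpan G (Φ i) → W ≠ ⊥ →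
      (∀ (k : G) (f : E i → ℚ), f ∈ W → (fun y => f (k • y)) ∈ W) → W = antiSpan G (Φ i)) :
    ∃ T : Finset I, typeRank G (sigmaType Φ) + T.card = (∑ i ∈ T, typeRank G (Φ i)) + 1 := by
  obtain ⟨T, hT⟩ := exists_finrank_antiSpan_sigmaType_eq_sum Φ hirr
  obtain ⟨i₀⟩ := ‹Nonempty I›
  haveI : Nonempty (Σ i, E i) := ⟨⟨i₀, Classical.arbitrary (E i₀)⟩⟩
  refine ⟨T, ?_⟩
  rw [(IsCMTypeWith.sigmaType h).typeRank_eq_finrank_antiSpan_add_one, hT,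
    Finset.sum_congr rfl fun i _ => (h i).typeRank_eq_finrank_antiSpan_add_one, Finset.sum_add_distrib,
    Finset.sum_const, smul_eq_mul, mul_one]
  omega

end SubsetSum

/-! ### §2 One irreducible slot set: `dim U(Σ)` is a multiple of `dim A` -/

section Multiple

variable [DecidableEq I] [Fintype I] [Fintype X] [Nonempty X]

/-- **Same-slot family with type vectors in ONE irreducible stable `A ≤ ℚ^X`: `dim U(Σ) = r · dim A` with `r ≤ |I|`.**
[cite: Gordon1999HodgeAVSurvey, §3 Theorem (proof)] [cite: Serre1977, §2.2] -/
theorem exists_finrank_antiSpan_sigmaType_eq_mul {A : Submodule ℚ (X → ℚ)}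
    (hAst : ∀ (k : G) (a : X → ℚ), a ∈ A → (fun x => a (k • x)) ∈ A)
    (hirr : ∀ W : Submodule ℚ (X → ℚ), W ≤ A → W ≠ ⊥ →
      (∀ (k : G) (f : X → ℚ), f ∈ W → (fun y => f (k • y)) ∈ W) → W = A)
    (Φ : I → Set X) (hu : ∀ i, antiVec (Φ i) (1 : G) ∈ A) :
    ∃ r : ℕ, r ≤ Fintype.card I ∧
      Module.finrank ℚ (antiSpan G (sigmaType (E := fun _ : I => X) Φ)) = r * Module.finrank ℚ A := by
  have hU : ∀ i, antiSpan G (Φ i) = A := fun i => antiSpan_eq_of_irreducible hAst hirr (hu i)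
  obtain ⟨T, hT⟩ := exists_finrank_antiSpan_sigmaType_eq_sum (E := fun _ : I => X) Φ fun i => by
    rw [hU i]; exact hirr
  refine ⟨T.card, (Finset.card_le_univ T), ?_⟩
  rw [hT, Finset.sum_congr rfl fun i _ => by rw [hU i], Finset.sum_const, smul_eq_mul]

/-- **CM types of an (IRR) slot: `rank(Σ) = r · (|X|/2) + 1` with `r ≤ |I|`** — the rank less one of every same-slot
family (`dim Hg(A_1 × ⋯ × A_k)` for varieties with CM by one (IRR) field) is a MULTIPLE of `n = |X|/2`; `r = |I|` iff
the family is nondegenerate, and then `2|I| ≤ n` off multiplicity one (F1b/F5). [cite: Gordon1999HodgeAVSurvey, §3 Theorem (proof) and 7.5–7.7] -/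
theorem exists_typeRank_sigmaType_eq_mul_add_one [Nonempty I] {ρ : G} (Φ : I → Set X)
    (h : ∀ i, IsCMTypeWith ρ (Φ i))
    (hirr : ∀ W : Submodule ℚ (X → ℚ), W ≤ antiWeights (E := X) ρ → W ≠ ⊥ →
      (∀ (k : G) (f : X → ℚ), f ∈ W → (fun y => f (k • y)) ∈ W) → W = antiWeights (E := X) ρ) :
    ∃ r : ℕ, r ≤ Fintype.card I ∧ typeRank G (sigmaType (E := fun _ : I => X) Φ) = r * (Fintype.card X / 2) + 1 := by
  have i₀ := Classical.arbitrary I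
  obtain ⟨r, hr, hfin⟩ := exists_finrank_antiSpan_sigmaType_eq_mul (comp_smul_mem_antiWeights (h i₀).comm) hirr Φ
    fun i => antiVec_mem_antiWeights (h i) 1
  haveI : Nonempty (Σ _ : I, X) := ⟨⟨i₀, Classical.arbitrary X⟩⟩
  refine ⟨r, hr, ?_⟩
  rw [(IsCMTypeWith.sigmaType (E := fun _ : I => X) h).typeRank_eq_finrank_antiSpan_add_one, hfin,
    finrank_antiWeights_eq_of_typeRank_eq (h i₀) (typeRank_eq_of_irreducible (h i₀) hirr)]

/-- **Divisibility form**: `|X|/2 ∣ rank(Σ) − 1`. [cite: Gordon1999HodgeAVSurvey, §3 Theorem (proof) and 7.5–7.7] -/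
theorem card_div_two_dvd_typeRank_sigmaType_sub_one [Nonempty I] {ρ : G} (Φ : I → Set X)
    (h : ∀ i, IsCMTypeWith ρ (Φ i))
    (hirr : ∀ W : Submodule ℚ (X → ℚ), W ≤ antiWeights (E := X) ρ → W ≠ ⊥ →
      (∀ (k : G) (f : X → ℚ), f ∈ W → (fun y => f (k • y)) ∈ W) → W = antiWeights (E := X) ρ) :
    Fintype.card X / 2 ∣ typeRank G (sigmaType (E := fun _ : I => X) Φ) - 1 := by
  obtain ⟨r, -, hr⟩ := exists_typeRank_sigmaType_eq_mul_add_one Φ h hirr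
  exact ⟨r, by rw [hr, Nat.add_sub_cancel, mul_comm]⟩

end Multiple

end Summit.HodgeConjecture.CorCM.IrrOdd

end
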